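import Summits.ABC.IUTFork.Cor312PilotIdelesPrCapstone
import HarnessLib

/-!
# [IUTchIII] Corollary 3.12 at the print-normalised assembled real setting with pilot regions read off ideles —
# the Θ-SIDE NUMBERS: every Kummer image of the Θ-pilot object has global volume `−deĝ(P_{Θ,j})`, hence
# `−deĝ_lgp(P_Θ) ≤ −|log(Θ)|`, `−deĝ_lgp(P_Θ) < −deĝ(P_q) = −|log(q)|`, and the GLOBAL B-INPUT is FALSE here

PROOF-ONLY record file (D-0012; no definitions) of the abc-iut cell (Cor. 3.12 sub-crew, seat abc-iut-c312-7, gen 3;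
D-0067 TEAM A row A-0 coda «A-0 AT THE PRINT-NORMALISED SETTING»); TAKES NO SIDE. Companion of this seat's
`Cor312PilotIdelesPrNumbers` (the `q`-side number `−|log(q)| = −deĝ(P_q)`) and `Cor312PilotIdelesPrCapstone`
(`ThetaFinite`, `BridgeHyps`, `Statement ↔ ↑(−deĝ(P_q)) ≤ −|log(Θ)|`) at abc-iut-c312-1's packet-normalised setting
with abc-iut-c312-3's sharp Dupuy–Hilado regions (`Real.settingPrVolSharp`). For Θ-ideles REALISING `P_Θ` in
Dupuy–Hilado's normalisation (3.4), `log ‖t_{Θ,j,v}‖ = −P_{Θ,j}(v)·ln|κ(v)|/n_v` ([IUTchIII] Def. 3.8 (i) p. 112: the Θ-pilot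
object is the `q̲^{j²}`-line bundle, `P_{Θ,j} = j²·P_q`, Dupuy–Hilado §3.3):

* §1 `logvol_thetaRegion_sharp_Pr_inr` — every `(n,m)`-Kummer image of the Θ-pilot object (the sharp boxes do not
  depend on `m`: Dupuy–Hilado §4.10 (Ind3)-collapse) has local volume `−(1/[F:ℚ])·Σ_{v|p} P_{Θ,i+1}(v)·log N(v)` at
  `(i+1, p)` and `0` at `∞`; `finsum_logvol_thetaRegion_sharp_Pr = −deĝ(P_{Θ,i+1})` (Dupuy–Hilado Thm. 3.10.1 (ii) for
  the Θ-pilot at the REAL packets, print-normalised);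
* §2 `processionNormalized_thetaRegion_settingPrVolSharp` — for EVERY assignment of lattice positions the
  procession-normalized global volume of the chosen Kummer images is `−deĝ_lgp(P_Θ)` (`LgpDivisor.ndegLgp`);
* §3 **`neg_ndegLgp_le_negLogTheta_settingPrVolSharp`**: `↑(−deĝ_lgp(P_Θ)) ≤ −|log(Θ)|` — the holomorphic hull of the
  union of the possible images CONTAINS each image and log-volumes are monotone (abc-iut-c312-6
  `logvol_thetaRegion_le_thetaLocal_of_mono`): the TRIVIAL direction, kernel-checked with the printed normalisations;
* §4 **`neg_ndegLgp_thetaPilot_lt_negLogQ_settingPrVolSharp`**: `−deĝ_lgp(P_Θ) < −deĝ(P_q) = −|log(q)|`, the constant being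
  Dupuy–Hilado's `deĝ_lgp(P_Θ) = ((ℓ⋇+1)(2ℓ⋇+1)/6)·deĝ(P_q)` (abc-iut-c312-3 `degLgp_thetaPilot`, `one_lt_avgWeight`); hence
  **`not_globalVolumeTransport_settingPrVolSharp`** / **`not_volumeTransport_settingPrVolSharp`**: TEAM B's GAP input
  (G-c312-11-1; [IUTchIII] Step (xi-g) p. 184 l. 30–34 read as a volume comparison of the pilot REGIONS) is FALSE at
  this setting — the print-normalised, GLOBAL twin of abc-iut-c312-11's `Cor312SharpNotBInputDH` (there: per packet, at
  `settingDHVolSharp`, under an inequality hypothesis; here: the inequality is Dupuy–Hilado's theorem and the number is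
  global). So at the print-normalised real setting with the sharp regions the kernel holds BOTH
  `−((ℓ⋇+1)(2ℓ⋇+1)/6)·deĝ(P_q) ≤ −|log(Θ)|` AND `Statement ↔ −deĝ(P_q) ≤ −|log(Θ)|`: whatever yields the printed
  inequality here must come from the (Ind1)/(Ind2)-HULL raising the procession-normalised volume by at least
  `((ℓ⋇+1)(2ℓ⋇+1)/6 − 1)·deĝ(P_q) > 0` above the regions' own — Scholze–Stix's "`j²`" point (§2.2) as a number in the
  kernel at the real carriers; whether the indeterminacies do so is the cell's adjudication question, untouched here.
[claim: Mochizuki2012, status: disputed] for the quoted sentences; [cite: DupuyHilado2025, §3.3, §3.4, §3.9, Thm. 3.10.1,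
§4.10]; [cite: ScholzeStix2018, §2.2 pp. 9–10]. HONEST FRAMING: numbers at one instantiation under the sharp reading of
(Ind3); no claim about the author's intended regions beyond abc-iut-c312-3's record; nothing asserted or denied about
Cor. 3.12. typed ≠ proved; instantiated ≠ endorsed.
-/

noncomputable section

open Set Function NumberField IsDedekindDomain
open scoped Pointwise

namespace Summit.ABC

namespace IUTFork

namespace Thm311

namespace Real

open Cor312 Cor312Vol Literature.IUT.LogThetaLattice Literature.IUT.LogVolume

variable {F : Type} [Field F] [NumberField F] (X : PilotData F) {logv : PadicLogs F} (hlog : LogvAnalytic logv)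
  (M : Type) [Field M] [NumberField M]
  (archPk : ∀ (j : (thetaIndex X).Label) (vQ : (thetaIndex X).VQ), Set ((logShellsDH X logv).Packet j vQ))
  (archSub : ∀ (j : (thetaIndex X).Label) (v : (thetaIndex X).V),
    Set ((logShellsDH X logv).Packet j ((thetaIndex X).over v)))
  (Ψ : ℤ → ∀ v : (thetaIndex X).V, v ∈ (thetaIndex X).Vbad → Set ((logShellsDH X logv).StarPacket v))
  (act : ℤ → ∀ v : (thetaIndex X).V, v ∈ (thetaIndex X).Vbad →
    (logShellsDH X logv).StarPacket v → Module.End ℚ ((logShellsDH X logv).StarPacket v))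
  (Mmod : ℤ → ∀ j : (thetaIndex X).LabelStar, Set ((logShellsDH X logv).GlobalPacket j.1))
  (region : ℤ → ∀ j : (thetaIndex X).LabelStar, FinDivisor M → ∀ vQ : (thetaIndex X).VQ,
    Set ((logShellsDH X logv).Packet j.1 vQ))
  (n : ℤ) {HT : Type} {LogLink : HT → HT → Type} {IsFull : ∀ {s t : HT}, LogLink s t → Prop}
  (lat : LGPGaussianLogThetaLattice LogLink IsFull)
  {Frd : Type} {IsoF : Frd → Frd → Type} {Ob : Frd → Type} {realify : Frd → Frd} {Strip : Type}
  {IsoS : Strip → Strip → Type} {Mv : ∀ v : (thetaIndex X).V, v ∈ (thetaIndex X).Vbad → Type}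
  [∀ v h, Monoid (Mv v h)]
  (sig : GlobalLGPFrobenioidSignature (thetaIndex X).lstar (thetaIndex X).V (· ∈ (thetaIndex X).Vbad)
    Frd IsoF Ob realify Strip IsoS Mv)
  (split : SplittingMonoids Mv) {ObΔ : Type} {N : ∀ v : (thetaIndex X).V, v ∈ (thetaIndex X).Vbad → Type}
  [∀ v h, Monoid (N v h)] (qData : QPilotData ObΔ N)
  (t : ∀ (pp : Nat.Primes) (_ : Fin X.lstar) (x : (thetaIndex X).Fibre (.inr pp)),
    haveI : Fact (pp : ℕ).Prime := ⟨pp.2⟩; kOf X pp.1 x)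
  (ht0 : ∀ pp i x, t pp i x ≠ 0)
  /- the Θ-ideles REALISE `P_Θ` in Dupuy–Hilado's normalisation (3.4) -/
  (ht : ∀ (pp : Nat.Primes) (i : Fin X.lstar) (x : (thetaIndex X).Fibre (.inr pp)),
    haveI : Fact (pp : ℕ).Prime := ⟨pp.2⟩
    Real.log ‖t pp i x‖ = -(X.thetaPilot i (placeOf X pp.1 x)) * logNorm F (placeOf X pp.1 x) /
      localDegree F (placeOf X pp.1 x))

/-! ## §1. The volume of every Kummer image of the Θ-pilot object, sharp boxes, print-normalised -/

section Regions

variable (qCentre : ObΔ → ∀ (j : (thetaIndex X).Label) (vQ : (thetaIndex X).VQ),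
    ∀ s : factorIdxDH X hlog j vQ, factorFieldDH X hlog j vQ s)
  (hq : ∀ j vQ s, qCentre (qPilotObject qData) j vQ s ≠ 0)
  (hfin : ∀ j : (thetaIndex X).Label, (Function.support fun vQ =>
    ((situationPrVol X hlog M archPk archSub Ψ act Mmod region).D n).logvol j vQ
      (factorMapDH X hlog j vQ ⁻¹' hullSet (factorFieldDH X hlog j vQ) (qCentre (qPilotObject qData) j vQ))).Finite)

/-- Every `(n,m)`-Kummer image of the Θ-pilot object IS the preimage of the (constant-in-`m`) sharp box.
[cite: DupuyHilado2025, §4.10] -/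
theorem thetaRegion_sharp_Pr (m : ℤ) (j : (thetaIndex X).Label) (vQ : (thetaIndex X).VQ) :
    (settingPrVol X hlog M archPk archSub Ψ act Mmod region n lat sig split qData
        (fun _ _ => thetaBoxDH X hlog (sharpBoxDH X hlog t)) qCentre hq hfin).thetaRegion m j vQ =
      factorMapDH X hlog j vQ ⁻¹' thetaBoxDH X hlog (sharpBoxDH X hlog t) j vQ :=
  rfl

/-- At the archimedean place every Kummer image has log-volume `0` (trivial archimedean container). [folklore] -/
theorem logvol_thetaRegion_sharp_Pr_inl (m : ℤ) (j : (thetaIndex X).Label) (u : Unit) :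
    ((situationPrVol X hlog M archPk archSub Ψ act Mmod region).D n).logvol j (.inl u)
      ((settingPrVol X hlog M archPk archSub Ψ act Mmod region n lat sig split qData
        (fun _ _ => thetaBoxDH X hlog (sharpBoxDH X hlog t)) qCentre hq hfin).thetaRegion m j (.inl u)) = 0 :=
  logvol_situationPrVol_inl X hlog M archPk archSub Ψ act Mmod region n u j _

include ht0 ht in
/-- **The local volume of every Kummer image at `(i+1, p)` is `−(1/[F:ℚ])·Σ_{v|p} P_{Θ,i+1}(v)·log N(v)`** for Θ-ideles
realising `P_Θ` (this seat's expectation identity `logvol_preimage_pi_Pr_of_last` with `c := −P_{Θ,i+1}`; the region is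
`e⁻¹(Π_{v⃗} ι_j(t_{Θ,i+1,v_{i+1}})·(R_I)^∼)`, abc-iut-c312-3 `factorMap_preimage_boxOf`, `packetLogμ_sharpBoxDH`).
[cite: DupuyHilado2025, §3.9, Thm. 3.10.1] -/
theorem logvol_thetaRegion_sharp_Pr_inr (m : ℤ) (i : Fin (thetaIndex X).lstar) (pp : Nat.Primes) :
    ((situationPrVol X hlog M archPk archSub Ψ act Mmod region).D n).logvol (Setting.labelSucc i) (.inr pp)
      ((settingPrVol X hlog M archPk archSub Ψ act Mmod region n lat sig split qData
        (fun _ _ => thetaBoxDH X hlog (sharpBoxDH X hlog t)) qCentre hq hfin).thetaRegion m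
          (Setting.labelSucc i) (.inr pp)) =
      (∑ v ∈ placesOver F pp, -(X.thetaPilot i v) * logNorm F v) / Module.finrank ℚ F := by
  haveI : Fact (pp : ℕ).Prime := ⟨pp.2⟩
  rw [thetaRegion_sharp_Pr]
  have h := (presAtPr X hlog pp).factorMap_preimage_boxOf (sharpBoxDH X hlog t pp (Setting.labelSucc i))
  change (summandPiecesPr X hlog).logvol (Setting.labelSucc i) (.inr pp)
    ((fun x => (presAtPr X hlog pp).factorMap (Setting.labelSucc i) x) ⁻¹'
      (presAtPr X hlog pp).boxOf (sharpBoxDH X hlog t pp (Setting.labelSucc i))) = _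
  rw [h]
  refine logvol_preimage_pi_Pr_of_last X hlog pp (Setting.labelSucc i) _ (packetAdm_sharpBoxDH X hlog t ht0 pp _)
    (fun v => -(X.thetaPilot i v)) fun e => ?_
  show packetLogμ pp.1 ((presAt X hlog pp).kk e) (sharpBoxDH X hlog t pp (Setting.labelSucc i) e) = _
  rw [packetLogμ_sharpBoxDH X hlog t ht0, labelIdele_labelSucc]
  exact ht pp i _

include ht0 ht in
open scoped Classical in
/-- The local volumes of the Kummer images vanish off the primes under the support of `P_{Θ,i+1}` (`⊆ S`).
[claim: Mochizuki2012, status: disputed] -/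
theorem support_logvol_thetaRegion_sharp_Pr_subset (m : ℤ) (i : Fin (thetaIndex X).lstar) :
    (Function.support fun vQ : (thetaIndex X).VQ =>
        ((situationPrVol X hlog M archPk archSub Ψ act Mmod region).D n).logvol (Setting.labelSucc i) vQ
          ((settingPrVol X hlog M archPk archSub Ψ act Mmod region n lat sig split qData
            (fun _ _ => thetaBoxDH X hlog (sharpBoxDH X hlog t)) qCentre hq hfin).thetaRegion m
              (Setting.labelSucc i) vQ)) ⊆
      ↑((X.thetaPilot i).support.image fun v => (thetaIndex X).over (.inr v : Place F)) := by
  intro vQ hvQ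
  rw [Function.mem_support] at hvQ
  rcases vQ with u | pp
  · exact absurd (logvol_thetaRegion_sharp_Pr_inl X hlog M archPk archSub Ψ act Mmod region n lat sig split qData t
      qCentre hq hfin m _ u) hvQ
  · haveI : Fact (pp : ℕ).Prime := ⟨pp.2⟩
    rw [logvol_thetaRegion_sharp_Pr_inr X hlog M archPk archSub Ψ act Mmod region n lat sig split qData t ht0 ht
      qCentre hq hfin m i pp] at hvQ
    obtain ⟨v, hv, hJv⟩ : ∃ v ∈ placesOver F pp, -(X.thetaPilot i v) * logNorm F v ≠ 0 := by
      by_contra hcon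
      simp only [not_exists, not_and, not_not] at hcon
      exact hvQ (by rw [Finset.sum_eq_zero hcon, zero_div])
    rw [Finset.coe_image, Set.mem_image]
    refine ⟨v, Finset.mem_coe.mpr (Finsupp.mem_support_iff.mpr fun h0 => hJv (by simp [h0])), ?_⟩
    rw [over_inr_eq]
    exact congrArg Sum.inr (Subtype.ext ((mem_placesOver_iff_residueChar v).mp hv))

include ht0 ht in
/-- The local volumes of the Kummer images are finitely supported over `V_ℚ`. [claim: Mochizuki2012, status: disputed] -/
theorem finite_support_logvol_thetaRegion_sharp_Pr (m : ℤ) (i : Fin (thetaIndex X).lstar) :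
    (Function.support fun vQ : (thetaIndex X).VQ =>
        ((situationPrVol X hlog M archPk archSub Ψ act Mmod region).D n).logvol (Setting.labelSucc i) vQ
          ((settingPrVol X hlog M archPk archSub Ψ act Mmod region n lat sig split qData
            (fun _ _ => thetaBoxDH X hlog (sharpBoxDH X hlog t)) qCentre hq hfin).thetaRegion m
              (Setting.labelSucc i) vQ)).Finite := by
  classical
  exact (Finset.finite_toSet _).subset (support_logvol_thetaRegion_sharp_Pr_subset X hlog M archPk archSub Ψ act Mmod
    region n lat sig split qData t ht0 ht qCentre hq hfin m i)

include ht0 ht in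
open scoped Classical in
/-- **The global volume of every Kummer image of the Θ-pilot object at the label `j = i+1` is `−deĝ(P_{Θ,j})`**
(`= −FinDivisor.ndeg F (X.thetaPilot i)`; Dupuy–Hilado Thm. 3.10.1 (ii) for the Θ-pilot, prime by prime, at the REAL
packets with the print-normalised volumes). [cite: DupuyHilado2025, Thm. 3.10.1] -/
theorem finsum_logvol_thetaRegion_sharp_Pr (m : ℤ) (i : Fin (thetaIndex X).lstar) :
    ∑ᶠ vQ : (thetaIndex X).VQ,
        ((situationPrVol X hlog M archPk archSub Ψ act Mmod region).D n).logvol (Setting.labelSucc i) vQ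
          ((settingPrVol X hlog M archPk archSub Ψ act Mmod region n lat sig split qData
            (fun _ _ => thetaBoxDH X hlog (sharpBoxDH X hlog t)) qCentre hq hfin).thetaRegion m
              (Setting.labelSucc i) vQ) =
      -FinDivisor.ndeg F (X.thetaPilot i) := by
  rw [finsum_eq_sum_of_support_subset _ (support_logvol_thetaRegion_sharp_Pr_subset X hlog M archPk archSub Ψ act Mmod
    region n lat sig split qData t ht0 ht qCentre hq hfin m i)]
  have hterm : ∀ vQ ∈ (X.thetaPilot i).support.image fun v => (thetaIndex X).over (.inr v : Place F),
      ((situationPrVol X hlog M archPk archSub Ψ act Mmod region).D n).logvol (Setting.labelSucc i) vQ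
          ((settingPrVol X hlog M archPk archSub Ψ act Mmod region n lat sig split qData
            (fun _ _ => thetaBoxDH X hlog (sharpBoxDH X hlog t)) qCentre hq hfin).thetaRegion m
              (Setting.labelSucc i) vQ) =
        (∑ v ∈ (X.thetaPilot i).support with (thetaIndex X).over (.inr v : Place F) = vQ,
            -(X.thetaPilot i v) * logNorm F v) / Module.finrank ℚ F := by
    intro vQ hvQ
    obtain ⟨v₀, -, rfl⟩ := Finset.mem_image.mp hvQ
    haveI : Fact (residueChar F v₀).Prime := ⟨residueChar_prime F v₀⟩
    have h := logvol_thetaRegion_sharp_Pr_inr X hlog M archPk archSub Ψ act Mmod region n lat sig split qData t ht0 ht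
      qCentre hq hfin m i ⟨residueChar F v₀, residueChar_prime F v₀⟩
    rw [show (Sum.inr ⟨residueChar F v₀, residueChar_prime F v₀⟩ : (thetaIndex X).VQ) =
      (thetaIndex X).over (.inr v₀ : Place F) from rfl] at h
    rw [h]
    congr 1
    symm
    apply Finset.sum_subset
    · intro v hv
      rw [Finset.mem_filter] at hv
      have h1 := hv.2
      rw [over_inr_eq, over_inr_eq] at h1
      exact (mem_placesOver_iff_residueChar v).mpr (congrArg Subtype.val (Sum.inr.inj h1))
    · intro v hv hv'
      rw [Finset.mem_filter, not_and'] at hv'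
      have hres : (thetaIndex X).over (.inr v : Place F) = (thetaIndex X).over (.inr v₀ : Place F) := by
        rw [over_inr_eq, over_inr_eq]
        exact congrArg Sum.inr (Subtype.ext ((mem_placesOver_iff_residueChar v).mp hv))
      have hJ : X.thetaPilot i v = 0 := Finsupp.notMem_support_iff.mp (hv' hres)
      simp [hJ]
  rw [Finset.sum_congr rfl hterm, ← Finset.sum_div, Finset.sum_fiberwise_of_maps_to
    (g := fun v => (thetaIndex X).over (.inr v : Place F))
    (fun v hv => Finset.mem_image_of_mem (fun v => (thetaIndex X).over (.inr v : Place F)) hv),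
    FinDivisor.ndeg_apply, FinDivisor.deg_apply, Finsupp.sum, ← neg_div, ← Finset.sum_neg_distrib]
  refine congrArg (· / _) (Finset.sum_congr rfl fun v _ => ?_)
  ring

end Regions

/-! ## §2–§4. At `settingPrVolSharp`: `−deĝ_lgp(P_Θ) ≤ −|log(Θ)|`, `−deĝ_lgp(P_Θ) < −|log(q)|`, the global B-INPUT fails -/

section Sharp

variable (tq : ∀ (pp : Nat.Primes) (x : (thetaIndex X).Fibre (.inr pp)), haveI : Fact (pp : ℕ).Prime := ⟨pp.2⟩; kOf X pp.1 x)
  (htq0 : ∀ pp x, tq pp x ≠ 0)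
  (htq1 : ∀ (pp : Nat.Primes) (x : (thetaIndex X).Fibre (.inr pp)),
    haveI : Fact (pp : ℕ).Prime := ⟨pp.2⟩; placeOf X pp.1 x ∉ X.S → ‖tq pp x‖ = 1)

/-- `−deĝ_lgp(P_Θ)` is the procession-normalized family of the `−deĝ(P_{Θ,j})`. [cite: DupuyHilado2025, Def. 3.1.1] -/
theorem processionNormalized_neg_ndeg_thetaPilot :
    processionNormalized (fun i : Fin (thetaIndex X).lstar => -FinDivisor.ndeg F (X.thetaPilot i)) =
      -LgpDivisor.ndegLgp X.thetaPilot := by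
  simp only [processionNormalized, LgpDivisor.ndegLgp, Finset.sum_neg_distrib, neg_div, one_div_mul_eq_div]
  rfl

include ht0 ht in
/-- **For EVERY assignment of lattice positions, the procession-normalized global volume of the chosen Kummer images of
the Θ-pilot object at `settingPrVolSharp` is `−deĝ_lgp(P_Θ)`** (the boxes are constant in `m`).
[cite: DupuyHilado2025, Thm. 3.10.1] -/
theorem processionNormalized_thetaRegion_settingPrVolSharp (m : Fin (thetaIndex X).lstar → (thetaIndex X).VQ → ℤ) :
    processionNormalized (fun i : Fin (thetaIndex X).lstar => ∑ᶠ vQ : (thetaIndex X).VQ,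
        ((situationPrVol X hlog M archPk archSub Ψ act Mmod region).D n).logvol (Setting.labelSucc i) vQ
          ((settingPrVolSharp X hlog M archPk archSub Ψ act Mmod region n lat sig split qData tq t htq0 htq1).thetaRegion
            (m i vQ) (Setting.labelSucc i) vQ)) =
      -LgpDivisor.ndegLgp X.thetaPilot := by
  rw [← processionNormalized_neg_ndeg_thetaPilot X]
  congr 1
  funext i
  -- the `v_ℚ`-sum does not depend on the positions `m i v_ℚ`: compare with the constant position `0`
  have hpt : ∀ vQ, ((situationPrVol X hlog M archPk archSub Ψ act Mmod region).D n).logvol (Setting.labelSucc i) vQ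
        ((settingPrVolSharp X hlog M archPk archSub Ψ act Mmod region n lat sig split qData tq t htq0 htq1).thetaRegion
          (m i vQ) (Setting.labelSucc i) vQ) =
      ((situationPrVol X hlog M archPk archSub Ψ act Mmod region).D n).logvol (Setting.labelSucc i) vQ
        ((settingPrVolSharp X hlog M archPk archSub Ψ act Mmod region n lat sig split qData tq t htq0 htq1).thetaRegion
          0 (Setting.labelSucc i) vQ) := fun _ => rfl
  simp_rw [hpt]
  exact finsum_logvol_thetaRegion_sharp_Pr X hlog M archPk archSub Ψ act Mmod region n lat sig split qData t ht0 ht _ _ _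
    0 i

include ht0 ht in
/-- **`−deĝ_lgp(P_Θ) ≤ −|log(Θ)|` at `settingPrVolSharp`** — the TRIVIAL direction: the holomorphic hull of the union of the
possible images contains every single Kummer image and the packet-normalised log-volume is monotone on admissible
regions (abc-iut-c312-6 `logvol_thetaRegion_le_thetaLocal_of_mono`; `ThetaFinite`, `ThetaRegionsAdm`, `LogvolMono`
by this seat's capstone). [claim: Mochizuki2012, status: disputed] -/
theorem neg_ndegLgp_le_negLogTheta_settingPrVolSharp
    (ht1 : ∀ (pp : Nat.Primes) (i : Fin X.lstar) (x : (thetaIndex X).Fibre (.inr pp)),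
      haveI : Fact (pp : ℕ).Prime := ⟨pp.2⟩; placeOf X pp.1 x ∉ X.S → ‖t pp i x‖ = 1) :
    (((-LgpDivisor.ndegLgp X.thetaPilot : ℝ)) : WithTop ℝ) ≤
      (settingPrVolSharp X hlog M archPk archSub Ψ act Mmod region n lat sig split qData tq t htq0 htq1).negLogTheta := by
  have hfin := thetaFinite_settingPrVolSharp X hlog M archPk archSub Ψ act Mmod region n lat sig split qData t tq ht0 ht1
    htq0 htq1
  have hadm := thetaRegionsAdm_settingPrVolSharp X hlog M archPk archSub Ψ act Mmod region n lat sig split qData t tq ht0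
    htq0 htq1
  have hmono := logvolMono_settingPrVol X hlog M archPk archSub Ψ act Mmod region n lat sig split qData
    (fun _ _ => thetaBoxDH X hlog (sharpBoxDH X hlog t)) (fun _ => qCentreDH X hlog tq)
    (qCentreDH_ne_zero X hlog tq htq0)
    (finite_support_logvol_qRegion_Pr X hlog M archPk archSub Ψ act Mmod region n tq htq0 htq1)
  unfold Setting.negLogTheta
  rw [if_pos hfin, WithTop.coe_le_coe,
    ← processionNormalized_thetaRegion_settingPrVolSharp X hlog M archPk archSub Ψ act Mmod region n lat sig split qData
      t ht0 ht tq htq0 htq1 (fun _ _ => 0)]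
  refine processionNormalized_mono fun i => ?_
  exact finsum_le_finsum'
    (finite_support_logvol_thetaRegion_sharp_Pr X hlog M archPk archSub Ψ act Mmod region n lat sig split qData t ht0 ht
      _ _ _ 0 i)
    (hfin.2 i) fun vQ => logvol_thetaRegion_le_thetaLocal_of_mono hmono hfin hadm 0 i vQ

/-- **`−deĝ_lgp(P_Θ) < −deĝ(P_q)`** — Dupuy–Hilado's `deĝ_lgp(P_Θ) = ((ℓ⋇+1)(2ℓ⋇+1)/6)·deĝ(P_q) > deĝ(P_q)` (abc-iut-c312-3
`deg_qPilot_lt_degLgp_thetaPilot`), normalised by `[F:ℚ] > 0`. [cite: DupuyHilado2025, §3.3] -/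
theorem neg_ndegLgp_thetaPilot_lt_neg_ndeg_qPilot :
    -LgpDivisor.ndegLgp X.thetaPilot < -FinDivisor.ndeg F X.qPilot := by
  rw [LgpDivisor.ndegLgp_eq, FinDivisor.ndeg_apply, neg_lt_neg_iff]
  exact div_lt_div_of_pos_right X.deg_qPilot_lt_degLgp_thetaPilot FinDivisor.finrank_pos

include ht0 ht in
/-- **`−deĝ_lgp(P_Θ) < −|log(q)|` at `settingPrVolSharp`** for `q`-ideles realising `P_q`: the procession-normalized global
volume of the Kummer images of the Θ-pilot object (ANY positions) is STRICTLY BELOW the `q`-pilot volume.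
[cite: DupuyHilado2025, §3.3, Thm. 3.10.1] -/
theorem neg_ndegLgp_thetaPilot_lt_negLogQ_settingPrVolSharp
    (htq : ∀ (pp : Nat.Primes) (x : (thetaIndex X).Fibre (.inr pp)),
      haveI : Fact (pp : ℕ).Prime := ⟨pp.2⟩
      Real.log ‖tq pp x‖ = -(X.qPilot (placeOf X pp.1 x)) * logNorm F (placeOf X pp.1 x) /
        localDegree F (placeOf X pp.1 x))
    (m : Fin (thetaIndex X).lstar → (thetaIndex X).VQ → ℤ) :
    processionNormalized (fun i : Fin (thetaIndex X).lstar => ∑ᶠ vQ : (thetaIndex X).VQ,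
        ((situationPrVol X hlog M archPk archSub Ψ act Mmod region).D n).logvol (Setting.labelSucc i) vQ
          ((settingPrVolSharp X hlog M archPk archSub Ψ act Mmod region n lat sig split qData tq t htq0 htq1).thetaRegion
            (m i vQ) (Setting.labelSucc i) vQ)) <
      (settingPrVolSharp X hlog M archPk archSub Ψ act Mmod region n lat sig split qData tq t htq0 htq1).negLogQ := by
  rw [processionNormalized_thetaRegion_settingPrVolSharp X hlog M archPk archSub Ψ act Mmod region n lat sig split qData t
      ht0 ht tq htq0 htq1,
    negLogQ_settingPrVolSharp X hlog M archPk archSub Ψ act Mmod region n lat sig split qData t tq htq0 htq1 htq]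
  exact neg_ndegLgp_thetaPilot_lt_neg_ndeg_qPilot X

include ht0 ht in
/-- **TEAM B's GLOBAL gap input `GlobalVolumeTransport` is FALSE at `settingPrVolSharp`** with ideles realising `P_Θ` and
`P_q` ([IUTchIII] Step (xi-g), p. 184 l. 30–34, read as "the `q`-pilot volume is at most the (procession-normalized,
`v_ℚ`-summed) volume of chosen Kummer images of the Θ-pilot object": here every such sum is `−deĝ_lgp(P_Θ) < −deĝ(P_q)`).
The print-normalised GLOBAL twin of abc-iut-c312-11's per-packet `not_volumeTransport_settingDHVolSharp_of_lt`.
[claim: Mochizuki2012, status: disputed] -/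
theorem not_globalVolumeTransport_settingPrVolSharp
    (htq : ∀ (pp : Nat.Primes) (x : (thetaIndex X).Fibre (.inr pp)),
      haveI : Fact (pp : ℕ).Prime := ⟨pp.2⟩
      Real.log ‖tq pp x‖ = -(X.qPilot (placeOf X pp.1 x)) * logNorm F (placeOf X pp.1 x) /
        localDegree F (placeOf X pp.1 x)) :
    ¬ GlobalVolumeTransport (settingPrVolSharp X hlog M archPk archSub Ψ act Mmod region n lat sig split qData tq t htq0
      htq1) := by
  rintro ⟨m, -, hle⟩
  exact absurd hle (not_le.mpr (neg_ndegLgp_thetaPilot_lt_negLogQ_settingPrVolSharp X hlog M archPk archSub Ψ act Mmod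
    region n lat sig split qData t ht0 ht tq htq0 htq1 htq m))

include ht0 ht in
/-- … hence the PER-PACKET input `VolumeTransport` fails too (it implies the global one given `BridgeHyps` and
`ThetaRegionsAdm`, abc-iut-c312-12/c312-6 `globalVolumeTransport_of_volumeTransport`). [claim: Mochizuki2012, status: disputed] -/
theorem not_volumeTransport_settingPrVolSharp
    (ht1 : ∀ (pp : Nat.Primes) (i : Fin X.lstar) (x : (thetaIndex X).Fibre (.inr pp)),
      haveI : Fact (pp : ℕ).Prime := ⟨pp.2⟩; placeOf X pp.1 x ∉ X.S → ‖t pp i x‖ = 1)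
    (htq : ∀ (pp : Nat.Primes) (x : (thetaIndex X).Fibre (.inr pp)),
      haveI : Fact (pp : ℕ).Prime := ⟨pp.2⟩
      Real.log ‖tq pp x‖ = -(X.qPilot (placeOf X pp.1 x)) * logNorm F (placeOf X pp.1 x) /
        localDegree F (placeOf X pp.1 x)) :
    ¬ VolumeTransport (settingPrVolSharp X hlog M archPk archSub Ψ act Mmod region n lat sig split qData tq t htq0 htq1) :=
  fun hvt => not_globalVolumeTransport_settingPrVolSharp X hlog M archPk archSub Ψ act Mmod region n lat sig split qData t
    ht0 ht tq htq0 htq1 htq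
    (globalVolumeTransport_of_volumeTransport
      (bridgeHyps_settingPrVolSharp_of_ideles X hlog M archPk archSub Ψ act Mmod region n lat sig split qData t tq ht0 ht1
        htq0 htq1)
      (thetaRegionsAdm_settingPrVolSharp X hlog M archPk archSub Ψ act Mmod region n lat sig split qData t tq ht0 htq0 htq1)
      hvt)

end Sharp

end Real

end Thm311

end IUTFork

end Summit.ABC

end
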